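import Literature.Analysis.FluidPDE.ConvexIntegration2DIteration
import HarnessLib

/-!
# Convex integration in 2-D: variable data (strict subsolutions over continuous data, joint geometry, cylinders)

Topic `Analysis/FluidPDE`. Support file (sliced layer 2) for the proof of Székelyhidi's localized
convex-integration theorem `Torus.Szekelyhidi2011_thm13` (`EulerSubsolutionCriterion.lean`;
= De Lellis–Székelyhidi 2010, Prop. 2, localized to an open space–time region `U`, with *continuous,
non-constant* data `(v̄, ū, ē)` on `U`). The constructive machinery of
`ConvexIntegration2DSubsolutions/Step/Iteration.lean` (Chiodaroli–De Lellis–Kreml 2015) is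
written for a *constant* strict subsolution `(C, qt)`; here the data vary:

* `BaseData`: a bounded open `Ω ⊆ ℝ × ℝ²` carrying continuous `Cf = 2ē : Ω → ℝ` (bounded by
  `Cmax`) and `qb = (v̄₁, v̄₂, ū₁₁, ū₁₂) : Ω → State` with `qb(z) ∈ 𝒰_{Cf z}` (`InU`) on `Ω`
  (Székelyhidi 2011, hypotheses of Thm. 1.3 in the flat coordinates of
  `ConvexIntegration2DGeometricLemma.lean`); the bound `R = √Cmax + 2 Cmax` of all states;
* `MemX0v B p` — the space `X₀` over variable data (DLSz 2010, Def. 4.1, localized): smooth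
  perturbations `p` compactly supported in `Ω`, solving the linear system classically, with
  `qb z + p z ∈ 𝒰_{Cf z}` for all `z ∈ Ω`; basic API (`zero`, vanishing off `Ω`, `|p| ≤ 2R`,
  compactness of the range of the data map `z ↦ (Cf z, qb z + p z)` on compacts, uniform continuity);
* the geometric lemma made uniform *jointly in `(C, q)`* (`geometric_lemma_local₂`,
  `uniform_geometry₂`): on a compact set of pairs `(C, q)` with `q ∈ 𝒰_C` one segment datum per
  point serves all nearby pairs, with room — CDK Lemma 4.3 / DLSz Lemma 4.7 "by continuity", now
  also in the energy level `C = 2ē(x,t)`;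
* `Cyl B` — closed space–time cylinders `[a-m, b+m] × B̄(x, R+m) ⊆ Ω` (the covering "inside the
  region `U`" of Székelyhidi 2011, proof of Thm. 1.3), the *slice defect*
  `sdef B cy p t = ∫_{B(x,R)} (Cf - |v̄ + p|²)(t,x) dx` (DLSz 2010, the functional
  `∫_{Ω₀} [ē - ½|v|²] dx` at a fixed time, (4.2)), its bounds and its expansion under an increment;
* tools for the sliced perturbation step and iteration: finitely many disjoint planar discs
  exhausting a disc up to measure `λ` (`exists_finite_disc_family`, Besicovitch), the time stagger
  `|t - 2r(i + ν/3)| ≤ r/3` (`exists_time_stagger`; DLSz §4.5 Step 1, shifted grids), and the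
  recursion lemma with gains along a subsequence (`tendsto_zero_of_sq_recursion_sparse`).

## References

* L. Székelyhidi Jr., C. R. Math. Acad. Sci. Paris 349 (2011) 1063–1066, Thm. 1.3.
* C. De Lellis, L. Székelyhidi Jr., Arch. Ration. Mech. Anal. 195 (2010) 225–260, Def. 4.1–4.2,
  Lemma 4.7, §4.5 Step 1.
* E. Chiodaroli, C. De Lellis, O. Kreml, Comm. Pure Appl. Math. 68 (2015) 1157–1190, §4.1.
-/

noncomputable section

open MeasureTheory Set Metric Filter Function
open scoped ContDiff Topology

namespace Literature.Analysis.FluidPDE.ConvexIntegration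

/-! ### Joint geometry in the pair `(C, q)` -/

/-- `{(C, q) : q ∈ 𝒰_C}` is open in `ℝ × State`. [folklore] -/
theorem isOpen_setOf_inU₂ : IsOpen {x : ℝ × State | InU x.1 x.2} := by
  have h1 : Continuous fun x : ℝ × State => trM x.1 x.2 := by
    have : (fun x : ℝ × State => trM x.1 x.2) = fun x => x.1 - x.2 0 ^ 2 - x.2 1 ^ 2 := by
      funext x; rw [trM_eq]
    rw [this]; fun_prop
  have h2 : Continuous fun x : ℝ × State => detM x.1 x.2 := by
    unfold detM m11 m22 m12; fun_prop
  exact (isOpen_lt continuous_const h1).inter (isOpen_lt continuous_const h2)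

/-- The defect `tr M = C - |a|²` is jointly continuous in `(C, q)`. [folklore] -/
theorem continuous_trM₂ : Continuous fun x : ℝ × State => trM x.1 x.2 := by
  have : (fun x : ℝ × State => trM x.1 x.2) = fun x => x.1 - x.2 0 ^ 2 - x.2 1 ^ 2 := by
    funext x; rw [trM_eq]
  rw [this]; fun_prop

/-- The defect is at most the energy level: `tr M(q) = C - |a|² ≤ C`. [folklore] -/
theorem trM_le (C : ℝ) (q : State) : trM C q ≤ C := by
  rw [trM_eq]; nlinarith [sq_nonneg (q 0), sq_nonneg (q 1)]

/-- `𝒰_C` grows with `C`. [folklore] -/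
theorem InU.mono {C C' : ℝ} {q : State} (h : InU C q) (hC : C ≤ C') : InU C' q := by
  obtain ⟨ht, hd⟩ := h
  have hp := InU.m11_pos ⟨ht, hd⟩
  have hq := InU.m22_pos ⟨ht, hd⟩
  simp only [InU, trM, detM, m11, m22, m12] at *
  constructor
  · linarith
  · nlinarith

/-- **Local geometric lemma, jointly in `(C, q)`.** Around every pair `(C, q)` with `q ∈ 𝒰_C`
there are a radius `ρ > 0` and one segment datum `(n, μ, ℓ)` serving, with room `ρ`, all pairs
`(C', q')` within `ρ`: `ℓ ≥ tr M_{C'}(q')/(16√C')` and the `ρ`-neighbourhood of the segment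
`q' + sD`, `|s| ≤ ℓ`, lies in `𝒰_{C'}` (CDK §4.1 / DLSz Lemma 4.7 "by continuity", also in `C`).
[cite: ChiodaroliDeLellisKreml2015, §4.1] -/
theorem geometric_lemma_local₂ {C : ℝ} {q : State} (hq : InU C q) :
    ∃ ρ : ℝ, 0 < ρ ∧ ∃ (n : E2) (μ ℓ : ℝ), n 0 ^ 2 + n 1 ^ 2 = 1 ∧ 0 ≤ ℓ ∧
      (∀ C' : ℝ, ∀ q' : State, |C' - C| < ρ → dist q' q < ρ →
        trM C' q' / (16 * Real.sqrt C') ≤ ℓ) ∧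
      (∀ C' : ℝ, ∀ q' : State, |C' - C| < ρ → dist q' q < ρ → ∀ s : ℝ, |s| ≤ ℓ →
        ∀ y ∈ closedBall (q' + s • dirVec n μ) ρ, InU C' y) := by
  have hC : 0 < C := hq.const_pos
  obtain ⟨n, μ, ℓ, hn, -, hℓ, hseg⟩ := geometric_lemma hq
  have hsC : 0 < Real.sqrt C := Real.sqrt_pos.mpr hC
  have hdq : 0 < trM C q := hq.1
  have hℓ0 : 0 ≤ ℓ := le_trans (by positivity) hℓ
  -- the segment, as a compact subset of the open set `{(C', y) : y ∈ 𝒰_{C'}}`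
  set S : Set State := (fun s : ℝ => q + s • dirVec n μ) '' Icc (-ℓ) ℓ
  have hScpt : IsCompact S := isCompact_Icc.image (by fun_prop)
  have hKcpt : IsCompact (({C} : Set ℝ) ×ˢ S) := isCompact_singleton.prod hScpt
  have hKU : ({C} : Set ℝ) ×ˢ S ⊆ {x : ℝ × State | InU x.1 x.2} := by
    rintro ⟨C', y⟩ ⟨hC', s, hs, rfl⟩
    rw [mem_singleton_iff] at hC'
    subst hC'
    exact hseg s (abs_le.mpr ⟨by linarith [hs.1], hs.2⟩)
  obtain ⟨ρ₁, hρ₁, hthick⟩ := hKcpt.exists_cthickening_subset_open isOpen_setOf_inU₂ hKU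
  -- continuity of `(C', q') ↦ tr M_{C'}(q') / (16 √C')` at `(C, q)`
  have hcont : ContinuousAt (fun x : ℝ × State => trM x.1 x.2 / (16 * Real.sqrt x.1)) (C, q) := by
    refine continuous_trM₂.continuousAt.div ?_ (by positivity)
    exact (continuous_const.mul (Real.continuous_sqrt.comp continuous_fst)).continuousAt
  have hlt : trM C q / (16 * Real.sqrt C) < ℓ := by
    calc trM C q / (16 * Real.sqrt C) < trM C q / (8 * Real.sqrt C) := by
          rw [div_lt_div_iff₀ (by positivity) (by positivity)]; nlinarith
      _ ≤ ℓ := hℓ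
  have hev : ∀ᶠ x in 𝓝 (C, q), trM x.1 x.2 / (16 * Real.sqrt x.1) < ℓ :=
    hcont.eventually (gt_mem_nhds hlt)
  obtain ⟨ρ₂, hρ₂, hball⟩ := Metric.eventually_nhds_iff_ball.mp hev
  refine ⟨min (ρ₁ / 2) ρ₂, lt_min (by linarith) hρ₂, n, μ, ℓ, hn, hℓ0, ?_, ?_⟩
  · intro C' q' hC' hq'
    have hmem : (C', q') ∈ ball (C, q) ρ₂ := by
      rw [mem_ball, Prod.dist_eq, Real.dist_eq]
      exact max_lt (lt_of_lt_of_le hC' (min_le_right _ _)) (lt_of_lt_of_le hq' (min_le_right _ _))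
    exact (hball _ hmem).le
  · intro C' q' hC' hq' s hs y hy
    have h := @hthick (C', y)
    apply h
    rw [Metric.mem_cthickening_iff]
    have hmem : (C, q + s • dirVec n μ) ∈ ({C} : Set ℝ) ×ˢ S :=
      ⟨rfl, s, ⟨by linarith [(abs_le.mp hs).1], (abs_le.mp hs).2⟩, rfl⟩
    refine le_trans (Metric.infEDist_le_edist_of_mem hmem) ?_
    rw [edist_dist]
    apply ENNReal.ofReal_le_ofReal
    have hq'2 : dist q' q < ρ₁ / 2 := lt_of_lt_of_le hq' (min_le_left _ _)
    have hC'2 : |C' - C| < ρ₁ / 2 := lt_of_lt_of_le hC' (min_le_left _ _)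
    have hy2 : dist y (q' + s • dirVec n μ) ≤ ρ₁ / 2 :=
      (mem_closedBall.mp hy).trans (min_le_left _ _)
    rw [Prod.dist_eq, Real.dist_eq]
    refine max_le (by linarith) ?_
    calc dist y (q + s • dirVec n μ)
        ≤ dist y (q' + s • dirVec n μ) + dist (q' + s • dirVec n μ) (q + s • dirVec n μ) :=
          dist_triangle _ _ _
      _ = dist y (q' + s • dirVec n μ) + dist q' q := by rw [dist_add_right]
      _ ≤ ρ₁ / 2 + ρ₁ / 2 := add_le_add hy2 hq'2.le
      _ = ρ₁ := by ring

/-- **Uniform geometric lemma, jointly in `(C, q)`.** On a compact set `Q` of pairs `(C, q)` with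
`q ∈ 𝒰_C` there are `δ, ρ₀ > 0` such that every `(C, q) ∈ Q` carries one segment datum `(n, μ, ℓ)`
serving all pairs within `δ`, with room `ρ₀` (finite subcover and Lebesgue number, as in
`uniform_geometry`). [cite: ChiodaroliDeLellisKreml2015, §4.1] -/
theorem uniform_geometry₂ {Q : Set (ℝ × State)} (hQ : IsCompact Q)
    (hQU : ∀ x ∈ Q, InU x.1 x.2) :
    ∃ δ : ℝ, 0 < δ ∧ ∃ ρ₀ : ℝ, 0 < ρ₀ ∧ ∀ x ∈ Q, ∃ (n : E2) (μ ℓ : ℝ),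
      n 0 ^ 2 + n 1 ^ 2 = 1 ∧ 0 ≤ ℓ ∧
      (∀ C' : ℝ, ∀ q' : State, |C' - x.1| < δ → dist q' x.2 < δ →
        trM C' q' / (16 * Real.sqrt C') ≤ ℓ) ∧
      (∀ C' : ℝ, ∀ q' : State, |C' - x.1| < δ → dist q' x.2 < δ → ∀ s : ℝ, |s| ≤ ℓ →
        ∀ y ∈ closedBall (q' + s • dirVec n μ) ρ₀, InU C' y) := by
  choose! ρ hρ n μ ℓ hn hℓ h1 h2 using
    fun x : ℝ × State => fun hx : InU x.1 x.2 => geometric_lemma_local₂ hx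
  -- finite subcover of `Q` by the balls `B(x, ρ_x / 2)`
  obtain ⟨T, hT⟩ := hQ.elim_finite_subcover (fun x : Q => ball (x : ℝ × State) (ρ x / 2))
    (fun _ => isOpen_ball) (fun x hx => mem_iUnion.mpr ⟨⟨x, hx⟩, mem_ball_self
      (half_pos (hρ x (hQU x hx)))⟩)
  rcases T.eq_empty_or_nonempty with hTe | hTne
  · refine ⟨1, one_pos, 1, one_pos, fun x hx => ?_⟩
    have : x ∈ (⋃ i ∈ T, ball (i : ℝ × State) (ρ i / 2)) := hT hx
    simp [hTe] at this
  set ρ₀ : ℝ := T.inf' hTne (fun x => ρ x / 2)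
  have hρ₀ : 0 < ρ₀ := by
    simp only [ρ₀, Finset.lt_inf'_iff]
    exact fun x _ => half_pos (hρ x (hQU x x.2))
  have hρ₀le : ∀ x ∈ T, ρ₀ ≤ ρ x / 2 := fun x hx => Finset.inf'_le _ hx
  obtain ⟨δ, hδ, hleb⟩ := lebesgue_number_lemma_of_metric hQ
    (c := fun x : T => ball ((x : Q) : ℝ × State) (ρ x / 2)) (fun _ => isOpen_ball) (by
      intro x hx
      have := hT hx
      simp only [mem_iUnion] at this
      obtain ⟨i, hi, hxi⟩ := this
      exact mem_iUnion.mpr ⟨⟨i, hi⟩, hxi⟩)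
  refine ⟨δ, hδ, ρ₀, hρ₀, fun x hx => ?_⟩
  obtain ⟨i, hi⟩ := hleb x hx
  set xi : ℝ × State := ((i : Q) : ℝ × State)
  have hiU : InU xi.1 xi.2 := hQU _ (i : Q).2
  have hρi : 0 < ρ xi := hρ _ hiU
  have hsub : ball x δ ⊆ ball xi (ρ xi / 2) := hi
  refine ⟨n xi, μ xi, ℓ xi, hn _ hiU, hℓ _ hiU, fun C' q' hC' hq' => ?_,
    fun C' q' hC' hq' s hs y hy => ?_⟩
  · have hmem : (C', q') ∈ ball xi (ρ xi / 2) := hsub (by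
      rw [mem_ball, Prod.dist_eq, Real.dist_eq]; exact max_lt hC' hq')
    rw [mem_ball, Prod.dist_eq, Real.dist_eq, max_lt_iff] at hmem
    exact h1 _ hiU C' q' (by linarith [hmem.1]) (by linarith [hmem.2])
  · have hmem : (C', q') ∈ ball xi (ρ xi / 2) := hsub (by
      rw [mem_ball, Prod.dist_eq, Real.dist_eq]; exact max_lt hC' hq')
    rw [mem_ball, Prod.dist_eq, Real.dist_eq, max_lt_iff] at hmem
    refine h2 _ hiU C' q' (by linarith [hmem.1]) (by linarith [hmem.2]) s hs y ?_
    exact closedBall_subset_closedBall ((hρ₀le i i.2).trans (by linarith)) hy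

/-! ### Variable data: the base strict subsolution on an open bounded region -/

/-- **Base data of the localized convex-integration problem** (Székelyhidi 2011, hypotheses of
Thm. 1.3, in flat coordinates): a bounded open space–time region `Ω ⊆ ℝ × ℝ²`, the energy level
`Cf = 2ē` and the base state `qb = (v̄₁, v̄₂, ū₁₁, ū₁₂)`, continuous on `Ω`, with
`v̄ ⊗ v̄ - ū < ē Id`, i.e. `qb z ∈ 𝒰_{Cf z}`, for `z ∈ Ω`, and `0 < Cf ≤ Cmax` on `Ω`.
[cite: Szekelyhidi2011, Thm. 1.3 (hypotheses)] -/
structure BaseData where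
  /-- the space–time region -/
  Ω : Set ST
  /-- the energy level `2ē` -/
  Cf : ST → ℝ
  /-- the base state `(v̄, ū)` in flat coordinates -/
  qb : ST → State
  /-- a bound of the energy level -/
  Cmax : ℝ
  isOpen : IsOpen Ω
  isBounded : Bornology.IsBounded Ω
  continuousOn_Cf : ContinuousOn Cf Ω
  continuousOn_qb : ContinuousOn qb Ω
  Cmax_pos : 0 < Cmax
  Cf_le : ∀ z ∈ Ω, Cf z ≤ Cmax
  inU : ∀ z ∈ Ω, InU (Cf z) (qb z)

namespace BaseData

variable (B : BaseData)

/-- The bound `R = √Cmax + 2 Cmax` of all coordinates of all states in `𝒰_C`, `C ≤ Cmax`.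
[folklore] -/
def R : ℝ := Real.sqrt B.Cmax + 2 * B.Cmax

/-- `R > 0`. [folklore] -/
theorem R_pos : 0 < B.R := by
  have := B.Cmax_pos; unfold R; positivity

/-- The energy level is positive on `Ω`. [folklore] -/
theorem Cf_pos {z : ST} (hz : z ∈ B.Ω) : 0 < B.Cf z := (B.inU z hz).const_pos

/-- States in the closed relaxation at an admissible energy level are bounded by `R`. [folklore] -/
theorem abs_le_R_of_inUbar {z : ST} (hz : z ∈ B.Ω) {q : State} (hq : InUbar (B.Cf z) q)
    (i : Fin 4) : |q i| ≤ B.R := by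
  have h := hq.coord_bound i
  have hle := B.Cf_le z hz
  have hs : Real.sqrt (B.Cf z) ≤ Real.sqrt B.Cmax := Real.sqrt_le_sqrt hle
  unfold R
  linarith

/-- The base state is bounded by `R` on `Ω`. [folklore] -/
theorem abs_qb_le {z : ST} (hz : z ∈ B.Ω) (i : Fin 4) : |B.qb z i| ≤ B.R :=
  B.abs_le_R_of_inUbar hz (B.inU z hz).inUbar i

/-- `Ω` is measurable. [folklore] -/
theorem measurableSet : MeasurableSet B.Ω := B.isOpen.measurableSet

/-- `Ω` has finite measure. [folklore] -/
theorem volume_lt_top : volume B.Ω < ⊤ := B.isBounded.measure_lt_top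

end BaseData

/-! ### The space `X₀` over variable data -/

/-- **The space `X₀` over variable data** (DLSz 2010, Def. 4.1, localized as in Székelyhidi
2011, proof of Thm. 1.3): smooth perturbations `p = (v̲, u̲)` (four scalar fields) compactly
supported in `Ω`, solving the linear system classically, such that `qb z + p z ∈ 𝒰_{Cf z}` for
every `z ∈ Ω` (strict subsolution with respect to `ē` on `Ω`, unchanged data off the supports).
[cite: DeLellisSzekelyhidi2010, Def. 4.1] -/
structure MemX0v (B : BaseData) (p : Fin 4 → ST → ℝ) : Prop where
  /-- smoothness -/
  smooth : ∀ i, ContDiff ℝ ∞ (p i)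
  /-- compact support -/
  hasCompactSupport : ∀ i, HasCompactSupport (p i)
  /-- support inside `Ω` -/
  tsupport_subset : ∀ i, tsupport (p i) ⊆ B.Ω
  /-- the linear system holds classically -/
  solves : SolvesLinear p
  /-- strict subsolution on `Ω` -/
  inU : ∀ z ∈ B.Ω, InU (B.Cf z) (B.qb z + fun i => p i z)

namespace MemX0v

variable {B : BaseData} {p : Fin 4 → ST → ℝ}

/-- The zero perturbation lies in `X₀`. [folklore] -/
theorem zero (B : BaseData) : MemX0v B (fun _ _ => 0) where
  smooth _ := contDiff_const
  hasCompactSupport _ := HasCompactSupport.zero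
  tsupport_subset _ := by simp
  solves := SolvesLinear.zero
  inU z hz := by
    have : (B.qb z + fun _ => (0 : ℝ)) = B.qb z := by ext i; simp
    rw [this]; exact B.inU z hz

/-- Elements of `X₀` vanish off `Ω`. [folklore] -/
theorem p_eq_zero (hp : MemX0v B p) {z : ST} (hz : z ∉ B.Ω) (i : Fin 4) : p i z = 0 :=
  image_eq_zero_of_notMem_tsupport fun h => hz (hp.tsupport_subset i h)

/-- The components of an element of `X₀` are continuous. [folklore] -/
theorem continuous (hp : MemX0v B p) (i : Fin 4) : Continuous (p i) := (hp.smooth i).continuous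

/-- **Uniform bound:** `|p| ≤ 2R` for every element of `X₀` (both `qb` and `qb + p` lie in the
bounded set `𝒰`). [folklore] -/
theorem abs_le (hp : MemX0v B p) (i : Fin 4) (z : ST) : |p i z| ≤ 2 * B.R := by
  by_cases hz : z ∈ B.Ω
  · have h1 : |(B.qb z + fun i => p i z) i| ≤ B.R := B.abs_le_R_of_inUbar hz (hp.inU z hz).inUbar i
    have h2 : |B.qb z i| ≤ B.R := B.abs_qb_le hz i
    simp only [Pi.add_apply] at h1
    calc |p i z| = |(B.qb z i + p i z) - B.qb z i| := by ring_nf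
      _ ≤ |B.qb z i + p i z| + |B.qb z i| := abs_sub _ _
      _ ≤ B.R + B.R := add_le_add h1 h2
      _ = 2 * B.R := by ring
  · rw [hp.p_eq_zero hz, abs_zero]; linarith [B.R_pos]

/-- The full state `qb + p` is bounded by `R` on `Ω`. [folklore] -/
theorem abs_state_le (hp : MemX0v B p) {z : ST} (hz : z ∈ B.Ω) (i : Fin 4) :
    |B.qb z i + p i z| ≤ B.R := by
  have := B.abs_le_R_of_inUbar hz (hp.inU z hz).inUbar i
  simpa using this

/-- The defect density of an element of `X₀` is positive on `Ω` and at most `Cmax`. [folklore] -/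
theorem trM_pos (hp : MemX0v B p) {z : ST} (hz : z ∈ B.Ω) :
    0 < trM (B.Cf z) (B.qb z + fun i => p i z) := (hp.inU z hz).1

/-- The defect density is at most `Cmax` on `Ω`. [folklore] -/
theorem trM_le_Cmax (B : BaseData) (p : Fin 4 → ST → ℝ) {z : ST} (hz : z ∈ B.Ω) :
    trM (B.Cf z) (B.qb z + fun i => p i z) ≤ B.Cmax :=
  (trM_le _ _).trans (B.Cf_le z hz)

/-- The data map `z ↦ (Cf z, qb z + p z)` is continuous on `Ω`. [folklore] -/
theorem continuousOn_data (hp : MemX0v B p) :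
    ContinuousOn (fun z => (B.Cf z, B.qb z + fun i => p i z)) B.Ω :=
  B.continuousOn_Cf.prodMk (B.continuousOn_qb.add
    (continuous_pi fun i => hp.continuous i).continuousOn)

/-- On a compact `K ⊆ Ω` the data map ranges in a compact set of admissible pairs. [folklore] -/
theorem exists_compact_data (hp : MemX0v B p) {K : Set ST} (hK : IsCompact K) (hKΩ : K ⊆ B.Ω) :
    ∃ Q : Set (ℝ × State), IsCompact Q ∧ (∀ z ∈ K, (B.Cf z, B.qb z + fun i => p i z) ∈ Q) ∧
      ∀ x ∈ Q, InU x.1 x.2 := by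
  refine ⟨(fun z => (B.Cf z, B.qb z + fun i => p i z)) '' K,
    hK.image_of_continuousOn (hp.continuousOn_data.mono hKΩ), fun z hz => ⟨z, hz, rfl⟩, ?_⟩
  rintro _ ⟨z, hz, rfl⟩
  exact hp.inU z (hKΩ hz)

/-- **Uniform continuity of the data on a compact `K ⊆ Ω`:** for `δ > 0` there is `r₀ > 0` such
that points of `K` at distance `< r₀` have data within `δ` (in `C` and in the state).
[folklore] -/
theorem exists_radius_data (hp : MemX0v B p) {K : Set ST} (hK : IsCompact K) (hKΩ : K ⊆ B.Ω)
    {δ : ℝ} (hδ : 0 < δ) :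
    ∃ r₀ : ℝ, 0 < r₀ ∧ ∀ z ∈ K, ∀ z' ∈ K, dist z z' < r₀ →
      |B.Cf z - B.Cf z'| < δ ∧ dist (B.qb z + fun i => p i z) (B.qb z' + fun i => p i z') < δ := by
  have huc := hK.uniformContinuousOn_of_continuous (hp.continuousOn_data.mono hKΩ)
  obtain ⟨r₀, hr₀, h⟩ := Metric.uniformContinuousOn_iff.mp huc δ hδ
  refine ⟨r₀, hr₀, fun z hz z' hz' hzz' => ?_⟩
  have h' := h z hz z' hz' hzz'
  rw [Prod.dist_eq, max_lt_iff, Real.dist_eq] at h'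
  exact h'

end MemX0v

/-! ### Cylinders inside the region and the slice defect -/

/-- A **target cylinder** of the base region: times `[a, b]`, the planar disc `B(x, R)`, and a
margin `m > 0` such that the closed enlarged cylinder `[a-m, b+m] × B̄(x, R+m)` lies in `Ω`
(the covering "inside the region `U`" of Székelyhidi 2011, proof of Thm. 1.3).
[cite: Szekelyhidi2011, Thm. 1.3 (proof sketch)] -/
structure Cyl (B : BaseData) where
  /-- initial time -/
  a : ℝ
  /-- final time -/
  b : ℝ
  /-- centre of the disc -/
  x : E2
  /-- radius of the disc -/
  R : ℝ
  /-- margin -/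
  m : ℝ
  hab : a ≤ b
  hR : 0 < R
  hm : 0 < m
  subset : Icc (a - m) (b + m) ×ˢ closedBall x (R + m) ⊆ B.Ω

namespace Cyl

variable {B : BaseData} (cy : Cyl B)

/-- The closed enlarged cylinder `[a-m, b+m] × B̄(x, R+m)`. [folklore] -/
def big : Set ST := Icc (cy.a - cy.m) (cy.b + cy.m) ×ˢ closedBall cy.x (cy.R + cy.m)

/-- The enlarged cylinder is compact. [folklore] -/
theorem isCompact_big : IsCompact cy.big := isCompact_Icc.prod (isCompact_closedBall _ _)

/-- The enlarged cylinder lies in `Ω`. [folklore] -/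
theorem big_subset : cy.big ⊆ B.Ω := cy.subset

/-- Membership in the enlarged cylinder. [folklore] -/
theorem mem_big_iff {z : ST} : z ∈ cy.big ↔
    z.1 ∈ Icc (cy.a - cy.m) (cy.b + cy.m) ∧ z.2 ∈ closedBall cy.x (cy.R + cy.m) := mem_prod

/-- Slices of the disc at admissible times lie in the enlarged cylinder. [folklore] -/
theorem mk_mem_big {t : ℝ} (ht : t ∈ Icc (cy.a - cy.m) (cy.b + cy.m)) {y : E2}
    (hy : y ∈ closedBall cy.x (cy.R + cy.m)) : (t, y) ∈ cy.big := ⟨ht, hy⟩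

/-- Slices of the disc at admissible times lie in `Ω`. [folklore] -/
theorem mk_mem_Ω {t : ℝ} (ht : t ∈ Icc (cy.a - cy.m) (cy.b + cy.m)) {y : E2}
    (hy : y ∈ closedBall cy.x (cy.R + cy.m)) : (t, y) ∈ B.Ω := cy.big_subset (cy.mk_mem_big ht hy)

/-- The core times lie in the admissible time range. [folklore] -/
theorem Icc_subset_Icc : Icc cy.a cy.b ⊆ Icc (cy.a - cy.m) (cy.b + cy.m) :=
  Set.Icc_subset_Icc (by linarith [cy.hm]) (by linarith [cy.hm])

/-- The open disc lies in the enlarged closed disc. [folklore] -/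
theorem ball_subset_closedBall_big : ball cy.x cy.R ⊆ closedBall cy.x (cy.R + cy.m) :=
  ball_subset_closedBall.trans (closedBall_subset_closedBall (by linarith [cy.hm]))

/-- A function continuous on `Ω` has continuous slices on the enlarged disc at admissible times.
[folklore] -/
theorem continuousOn_slice {F : Type*} [TopologicalSpace F] {f : ST → F}
    (hf : ContinuousOn f B.Ω) {t : ℝ} (ht : t ∈ Icc (cy.a - cy.m) (cy.b + cy.m)) :
    ContinuousOn (fun y : E2 => f (t, y)) (closedBall cy.x (cy.R + cy.m)) :=
  hf.comp (Continuous.prodMk_right t).continuousOn fun _ hy => cy.mk_mem_Ω ht hy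

/-- Slices of a function continuous on `Ω` are integrable on the disc at admissible times.
[folklore] -/
theorem integrableOn_slice {f : ST → ℝ} (hf : ContinuousOn f B.Ω) {t : ℝ}
    (ht : t ∈ Icc (cy.a - cy.m) (cy.b + cy.m)) :
    IntegrableOn (fun y : E2 => f (t, y)) (ball cy.x cy.R) :=
  ((cy.continuousOn_slice hf ht).integrableOn_compact (isCompact_closedBall _ _)).mono_set
    cy.ball_subset_closedBall_big

end Cyl

/-- **The slice defect** of a perturbation `p` on the target cylinder at time `t`:
`J_t(p) = ∫_{B(x,R)} tr M_{Cf}(qb + p)(t,y) dy = ∫_{B(x,R)} (2ē - |v̄ + v̲|²)(t,y) dy`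
(DLSz 2010, the integrand of the functional `I_{ε,Ω₀}` at a fixed time, with the opposite sign).
[cite: DeLellisSzekelyhidi2010, Def. 4.2] -/
def sdef (B : BaseData) (cy : Cyl B) (p : Fin 4 → ST → ℝ) (t : ℝ) : ℝ :=
  ∫ y in ball cy.x cy.R, trM (B.Cf (t, y)) (B.qb (t, y) + fun i => p i (t, y))

section SliceDefect

variable {B : BaseData} (cy : Cyl B) {p : Fin 4 → ST → ℝ}

/-- The defect density of `X₀`-elements, sliced, is continuous on the enlarged disc. [folklore] -/
theorem Cyl.continuousOn_trM_slice (hp : MemX0v B p) {t : ℝ}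
    (ht : t ∈ Icc (cy.a - cy.m) (cy.b + cy.m)) :
    ContinuousOn (fun y : E2 => trM (B.Cf (t, y)) (B.qb (t, y) + fun i => p i (t, y)))
      (closedBall cy.x (cy.R + cy.m)) := by
  have h := (cy.continuousOn_slice hp.continuousOn_data ht)
  exact continuous_trM₂.comp_continuousOn h

/-- The sliced defect density is integrable on the disc. [folklore] -/
theorem Cyl.integrableOn_trM_slice (hp : MemX0v B p) {t : ℝ}
    (ht : t ∈ Icc (cy.a - cy.m) (cy.b + cy.m)) :
    IntegrableOn (fun y : E2 => trM (B.Cf (t, y)) (B.qb (t, y) + fun i => p i (t, y)))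
      (ball cy.x cy.R) :=
  ((cy.continuousOn_trM_slice hp ht).integrableOn_compact (isCompact_closedBall _ _)).mono_set
    cy.ball_subset_closedBall_big

/-- The slice defect is non-negative (at admissible times). [folklore] -/
theorem sdef_nonneg (hp : MemX0v B p) {t : ℝ} (ht : t ∈ Icc (cy.a - cy.m) (cy.b + cy.m)) :
    0 ≤ sdef B cy p t :=
  setIntegral_nonneg measurableSet_ball fun _ hy =>
    (hp.trM_pos (cy.mk_mem_Ω ht (cy.ball_subset_closedBall_big hy))).le

/-- The slice defect is at most `Cmax |B(x,R)|`. [folklore] -/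
theorem sdef_le (hp : MemX0v B p) {t : ℝ} (ht : t ∈ Icc (cy.a - cy.m) (cy.b + cy.m)) :
    sdef B cy p t ≤ B.Cmax * volume.real (ball cy.x cy.R) := by
  unfold sdef
  calc _ ≤ ∫ _ in ball cy.x cy.R, B.Cmax := by
        refine setIntegral_mono_on (cy.integrableOn_trM_slice hp ht)
          ((integrableOn_const_iff).mpr (Or.inr measure_ball_lt_top)) measurableSet_ball
          fun y hy => ?_
        exact MemX0v.trM_le_Cmax B p (cy.mk_mem_Ω ht (cy.ball_subset_closedBall_big hy))
    _ = B.Cmax * volume.real (ball cy.x cy.R) := by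
        rw [setIntegral_const, smul_eq_mul, mul_comm]

/-- Pointwise expansion of the defect density under an increment `w` of the state:
`tr M(q + w) = tr M(q) - (w₀² + w₁²) - 2(q₀w₀ + q₁w₁)`. [folklore] -/
theorem trM_add (C : ℝ) (q w : State) :
    trM C (q + w) = trM C q - (w 0 ^ 2 + w 1 ^ 2) - 2 * (q 0 * w 0 + q 1 * w 1) := by
  rw [trM_eq, trM_eq]
  simp only [Pi.add_apply]
  ring

/-- **Expansion of the slice defect under an increment** `w` (continuous): at admissible times,
`J_t(p + w) = J_t(p) - ∫_B (w₀² + w₁²)(t,·) - 2 ∫_B [w₀ (v̄₁ + p₀) + w₁ (v̄₂ + p₁)](t,·)`.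
[folklore] -/
theorem sdef_add (hp : MemX0v B p) {w : Fin 4 → ST → ℝ} (hw : ∀ i, Continuous (w i)) {t : ℝ}
    (ht : t ∈ Icc (cy.a - cy.m) (cy.b + cy.m)) :
    sdef B cy (fun i z => p i z + w i z) t = sdef B cy p t
      - (∫ y in ball cy.x cy.R, (w 0 (t, y) ^ 2 + w 1 (t, y) ^ 2))
      - 2 * ∫ y in ball cy.x cy.R, ((B.qb (t, y) 0 + p 0 (t, y)) * w 0 (t, y)
          + (B.qb (t, y) 1 + p 1 (t, y)) * w 1 (t, y)) := by
  have hpt : ∀ y, trM (B.Cf (t, y)) (B.qb (t, y) + fun i => p i (t, y) + w i (t, y))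
      = trM (B.Cf (t, y)) (B.qb (t, y) + fun i => p i (t, y))
        - (w 0 (t, y) ^ 2 + w 1 (t, y) ^ 2)
        - 2 * ((B.qb (t, y) 0 + p 0 (t, y)) * w 0 (t, y) + (B.qb (t, y) 1 + p 1 (t, y)) * w 1 (t, y)) := by
    intro y
    have : (B.qb (t, y) + fun i => p i (t, y) + w i (t, y))
        = (B.qb (t, y) + fun i => p i (t, y)) + fun i => w i (t, y) := by
      ext i; simp only [Pi.add_apply]; ring
    rw [this, trM_add]
    simp only [Pi.add_apply]
  -- integrability on the disc
  have hcont : ∀ i, ContinuousOn (fun y : E2 => B.qb (t, y) i + p i (t, y))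
      (closedBall cy.x (cy.R + cy.m)) := fun i =>
    ((continuous_apply i).comp_continuousOn (cy.continuousOn_slice B.continuousOn_qb ht)).add
      ((hp.continuous i).comp (Continuous.prodMk_right t)).continuousOn
  have hwc : ∀ i, Continuous (fun y : E2 => w i (t, y)) := fun i =>
    (hw i).comp (Continuous.prodMk_right t)
  have hI1 := cy.integrableOn_trM_slice hp ht
  have hI2 : IntegrableOn (fun y : E2 => w 0 (t, y) ^ 2 + w 1 (t, y) ^ 2) (ball cy.x cy.R) :=
    ((((hwc 0).pow 2).add ((hwc 1).pow 2)).continuousOn.integrableOn_compact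
      (isCompact_closedBall _ _)).mono_set cy.ball_subset_closedBall_big
  have hI3 : IntegrableOn (fun y : E2 => (B.qb (t, y) 0 + p 0 (t, y)) * w 0 (t, y)
      + (B.qb (t, y) 1 + p 1 (t, y)) * w 1 (t, y)) (ball cy.x cy.R) :=
    ((((hcont 0).mul (hwc 0).continuousOn).add ((hcont 1).mul (hwc 1).continuousOn)).integrableOn_compact
      (isCompact_closedBall _ _)).mono_set cy.ball_subset_closedBall_big
  have hI12 : IntegrableOn (fun y : E2 => trM (B.Cf (t, y)) (B.qb (t, y) + fun i => p i (t, y))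
      - (w 0 (t, y) ^ 2 + w 1 (t, y) ^ 2)) (ball cy.x cy.R) := hI1.sub hI2
  have hI3' : IntegrableOn (fun y : E2 => 2 * ((B.qb (t, y) 0 + p 0 (t, y)) * w 0 (t, y)
      + (B.qb (t, y) 1 + p 1 (t, y)) * w 1 (t, y))) (ball cy.x cy.R) := hI3.const_mul 2
  unfold sdef
  rw [setIntegral_congr_fun measurableSet_ball (fun y _ => hpt y),
    integral_sub hI12 hI3', integral_sub hI1 hI2, integral_const_mul]

end SliceDefect

/-! ### Finitely many disjoint planar discs exhausting a disc up to measure `λ` -/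

/-- **Disjoint small discs exhausting a disc** (measurable Besicovitch covering): for
`s, λ > 0`, finitely many pairwise disjoint closed discs `B̄(yₐ, ρₐ) ⊆ B(x, R)` with
`0 < ρₐ < s` and `|B(x,R)| ≤ ∑ₐ |B̄(yₐ, ρₐ)| + λ` (DLSz 2010, §4.5 Step 1: the grid of cubes
`Q_ζ ⊂ Ω₀` of size `h`, here replaced by a Besicovitch family). [cite: DeLellisSzekelyhidi2010, §4.5 (Step 1)] -/
theorem exists_finite_disc_family (x : E2) (R : ℝ) {s : ℝ} (hs : 0 < s) {lam : ℝ}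
    (hlam : 0 < lam) :
    ∃ (m : ℕ) (y : Fin m → E2) (ρ : Fin m → ℝ), (∀ a, 0 < ρ a) ∧ (∀ a, ρ a < s) ∧
      (∀ a, closedBall (y a) (ρ a) ⊆ ball x R) ∧
      (Pairwise fun a a' => Disjoint (closedBall (y a) (ρ a)) (closedBall (y a') (ρ a'))) ∧
      volume.real (ball x R) ≤ ∑ a, volume.real (closedBall (y a) (ρ a)) + lam := by
  set Ω : Set E2 := ball x R
  have hΩo : IsOpen Ω := isOpen_ball
  -- Besicovitch: a.e. cover of `Ω` by disjoint closed discs inside `Ω` of radius `< s`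
  obtain ⟨t, r, tcount, hts, hr, hnull, hdisj⟩ :=
    Besicovitch.exists_disjoint_closedBall_covering_ae
      (volume : Measure E2) (fun y => {ρ | closedBall y ρ ⊆ Ω}) Ω (fun y hy δ hδ => by
        obtain ⟨ε, hε, hball⟩ := Metric.isOpen_iff.mp hΩo y hy
        refine ⟨min (ε / 2) (δ / 2), ?_, ?_, ?_⟩
        · exact (closedBall_subset_ball
            ((min_le_left _ _).trans_lt (half_lt_self hε))).trans hball
        · exact lt_min (half_pos hε) (half_pos hδ)
        · exact (min_le_right _ _).trans_lt (half_lt_self hδ))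
      (fun _ => s) (fun _ _ => hs)
  haveI : Countable t := tcount.to_subtype
  set D : t → Set E2 := fun y => closedBall (y : E2) (r y)
  have hDm : ∀ y, MeasurableSet (D y) := fun y => measurableSet_closedBall
  have hDd : Pairwise (Disjoint on D) := fun i j hij =>
    hdisj i.2 j.2 (Subtype.coe_injective.ne hij)
  have hUΩ : (⋃ y, D y) ⊆ Ω := iUnion_subset fun y => (hr y y.2).1
  have hΩU : Ω =ᵐ[volume] (⋃ y, D y) := by
    refine ae_eq_set.mpr ⟨?_, ?_⟩
    · have : (⋃ y : t, D y) = ⋃ y ∈ t, closedBall y (r y) := by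
        simp only [D, biUnion_eq_iUnion]
      rw [this]; exact hnull
    · rw [sdiff_eq_empty.mpr hUΩ, measure_empty]
  have hgi : IntegrableOn (fun _ : E2 => (1 : ℝ)) Ω volume :=
    (integrableOn_const_iff).mpr (Or.inr measure_ball_lt_top)
  have hsum : HasSum (fun y : t => ∫ z in D y, (1 : ℝ)) (∫ z in Ω, (1 : ℝ)) := by
    rw [setIntegral_congr_set hΩU]
    exact hasSum_integral_iUnion hDm hDd (hgi.mono_set hUΩ)
  have hint : ∀ S : Set E2, ∫ z in S, (1 : ℝ) = volume.real S := fun S => by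
    rw [setIntegral_const, smul_eq_mul, mul_one]
  simp only [hint] at hsum
  set J := volume.real Ω
  -- a finite partial sum capturing all but `λ` of `J`
  obtain ⟨I, hI⟩ : ∃ I : Finset t, J - lam < ∑ y ∈ I, volume.real (D y) := by
    have hev := hsum.eventually (Ioi_mem_nhds (show J - lam < J by linarith))
    exact hev.exists
  -- reindex by `Fin m`
  set m := I.card
  set e : Fin m ≃ {y // y ∈ I} := I.equivFin.symm
  refine ⟨m, fun a => ((e a : t) : E2), fun a => r ((e a : t) : E2), fun a => (hr _ (e a).1.2).2.1,
    fun a => (hr _ (e a).1.2).2.2, fun a => (hr _ (e a).1.2).1, ?_, ?_⟩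
  · intro a a' haa'
    have hne : ((e a : t) : E2) ≠ ((e a' : t) : E2) := by
      intro h
      apply haa'
      apply e.injective
      exact Subtype.ext (Subtype.ext h)
    exact hdisj (e a).1.2 (e a').1.2 hne
  · have : ∑ y ∈ I, volume.real (D y) = ∑ a : Fin m, volume.real (closedBall ((e a : t) : E2) (r ((e a : t) : E2))) := by
      calc ∑ y ∈ I, volume.real (D y) = ∑ y : {y // y ∈ I}, volume.real (D y) :=
            (Finset.sum_coe_sort I _).symm
        _ = ∑ a : Fin m, volume.real (D (e a)) := by rw [← Equiv.sum_comp e]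
        _ = _ := rfl
    linarith [this ▸ hI]

/-! ### The time stagger -/

/-- **Time stagger by thirds** (DLSz 2010, §4.5 Step 1: the time grids shifted by half a period
so that every time is well inside one family; here three families): for `r > 0` and every `t`
there are `ν ∈ {0,1,2}` and `i ∈ ℤ` with `|t - 2r(i + ν/3)| ≤ r/3`.
[cite: DeLellisSzekelyhidi2010, §4.5 (Step 1)] -/
theorem exists_time_stagger {r : ℝ} (hr : 0 < r) (t : ℝ) :
    ∃ (ν : Fin 3) (i : ℤ), |t - 2 * r * (i + (ν : ℕ) / 3)| ≤ r / 3 := by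
  set u : ℝ := 3 * t / (2 * r) with hu
  set m : ℤ := round u with hm
  have hround : |u - m| ≤ 1 / 2 := abs_sub_round u
  have h3 : (0 : ℤ) < 3 := by norm_num
  set i : ℤ := m / 3
  set k : ℤ := m % 3
  have hk0 : 0 ≤ k := Int.emod_nonneg _ (by norm_num)
  have hk3 : k < 3 := Int.emod_lt_of_pos _ h3
  have hi : i = m / 3 := rfl
  have hk : k = m % 3 := rfl
  have hmk : m = 3 * i + k := by omega
  refine ⟨⟨k.toNat, by omega⟩, i, ?_⟩
  have hkk : ((k.toNat : ℕ) : ℝ) = (k : ℝ) := by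
    have : (k.toNat : ℤ) = k := Int.toNat_of_nonneg hk0
    exact_mod_cast this
  simp only [hkk]
  have hm' : (m : ℝ) = 3 * (i : ℝ) + (k : ℝ) := by exact_mod_cast hmk
  have key : t - 2 * r * (i + (k : ℝ) / 3) = (2 * r / 3) * (u - m) := by
    rw [hm', hu]; field_simp
  rw [key, abs_mul, abs_of_pos (by positivity)]
  calc 2 * r / 3 * |u - ↑m| ≤ 2 * r / 3 * (1 / 2) := by gcongr
    _ = r / 3 := by ring

/-! ### The recursion lemma with gains along a subsequence -/

/-- Iterated almost-monotonicity: `J k ≤ J j + ∑_{m ∈ [j,k)} η m` for `j ≤ k`. [folklore] -/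
theorem le_add_sum_Ico_of_succ_le {J η : ℕ → ℝ} (hmono : ∀ k, J (k + 1) ≤ J k + η k)
    {j k : ℕ} (hjk : j ≤ k) : J k ≤ J j + ∑ m ∈ Finset.Ico j k, η m := by
  induction k, hjk using Nat.le_induction with
  | base => simp
  | succ k hjk ih =>
    rw [Finset.sum_Ico_succ_top hjk]
    linarith [hmono k]

/-- **Recursion lemma with sparse gains.** A non-negative sequence with
`J_{k+1} ≤ J_k + η_k` for all `k`, `∑ η_k < ∞`, and the quadratic gain
`J_{κ i + 1} ≤ J_{κ i} + η_{κ i} - β J_{κ i}²` along a strictly increasing subsequence `κ`,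
tends to `0`. [folklore] -/
theorem tendsto_zero_of_sq_recursion_sparse {J η : ℕ → ℝ} {β : ℝ} (hβ : 0 < β)
    (hJ0 : ∀ k, 0 ≤ J k) (hη0 : ∀ k, 0 ≤ η k) (hη : Summable η)
    (hmono : ∀ k, J (k + 1) ≤ J k + η k) {κ : ℕ → ℕ} (hκ : StrictMono κ)
    (hgain : ∀ i, J (κ i + 1) ≤ J (κ i) + η (κ i) - β * J (κ i) ^ 2) :
    Tendsto J atTop (𝓝 0) := by
  -- the subsequence and the block sums of `η`
  set J' : ℕ → ℝ := fun i => J (κ i)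
  set η' : ℕ → ℝ := fun i => ∑ m ∈ Finset.Ico (κ i) (κ (i + 1)), η m
  have hη'0 : ∀ i, 0 ≤ η' i := fun i => Finset.sum_nonneg fun m _ => hη0 m
  have hblocks : ∀ n, ∑ i ∈ Finset.range n, η' i = ∑ m ∈ Finset.Ico (κ 0) (κ n), η m := by
    intro n
    induction n with
    | zero => simp
    | succ n ih =>
      rw [Finset.sum_range_succ, ih]
      exact Finset.sum_Ico_consecutive _ (hκ.monotone (Nat.zero_le n)) (hκ.monotone n.le_succ)
  have hη's : Summable η' := by
    refine summable_of_sum_range_le hη'0 (c := ∑' m, η m) fun n => ?_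
    rw [hblocks]
    exact hη.sum_le_tsum _ fun m _ => hη0 m
  have hrec : ∀ i, J' (i + 1) ≤ J' i + η' i - β * J' i ^ 2 := by
    intro i
    have h1 : J (κ (i + 1)) ≤ J (κ i + 1) + ∑ m ∈ Finset.Ico (κ i + 1) (κ (i + 1)), η m :=
      le_add_sum_Ico_of_succ_le hmono (hκ i.lt_succ_self)
    have h2 : η' i = η (κ i) + ∑ m ∈ Finset.Ico (κ i + 1) (κ (i + 1)), η m := by
      simp only [η']
      rw [Finset.sum_eq_sum_Ico_succ_bot (hκ i.lt_succ_self)]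
    simp only [J']
    linarith [hgain i]
  have hJ' : Tendsto J' atTop (𝓝 0) :=
    tendsto_zero_of_sq_recursion hβ (fun i => hJ0 _) hη'0 hη's hrec
  -- tails of `η`
  set T : ℕ → ℝ := fun n => ∑' m, η (m + n)
  have hT0 : Tendsto T atTop (𝓝 0) := tendsto_sum_nat_add η
  have hTnonneg : ∀ n, 0 ≤ T n := fun n => tsum_nonneg fun m => hη0 _
  have hIco_le_T : ∀ j k, ∑ m ∈ Finset.Ico j k, η m ≤ T j := by
    intro j k
    have hs : Summable fun m => η (m + j) := (summable_nat_add_iff j).mpr hη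
    calc ∑ m ∈ Finset.Ico j k, η m = ∑ m ∈ Finset.range (k - j), η (j + m) :=
          Finset.sum_Ico_eq_sum_range _ _ _
      _ = ∑ m ∈ Finset.range (k - j), η (m + j) := by
          refine Finset.sum_congr rfl fun m _ => by rw [add_comm]
      _ ≤ T j := hs.sum_le_tsum _ fun m _ => hη0 _
  -- conclusion
  rw [Metric.tendsto_atTop]
  intro ε hε
  obtain ⟨i₁, hi₁⟩ := (Metric.tendsto_atTop.mp hJ') (ε / 2) (by linarith)
  obtain ⟨n₀, hn₀⟩ := (Metric.tendsto_atTop.mp (hT0.comp hκ.tendsto_atTop)) (ε / 2) (by linarith)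
  set i₀ := max i₁ n₀
  refine ⟨κ i₀, fun k hk => ?_⟩
  -- the largest `i` with `κ i ≤ k`
  set i := Nat.findGreatest (fun j => κ j ≤ k) k with hi_def
  have hik : κ i ≤ k := Nat.findGreatest_spec (P := fun j => κ j ≤ k) (m := i₀)
    ((hκ.id_le i₀).trans hk) hk
  have hi₀i : i₀ ≤ i := Nat.le_findGreatest ((hκ.id_le i₀).trans hk) hk
  have hki : k < κ (i + 1) := by
    by_contra hcon
    push Not at hcon
    have hle : i + 1 ≤ k := (hκ.id_le (i + 1)).trans hcon
    exact Nat.findGreatest_is_greatest (Nat.lt_succ_self i) hle hcon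
  have hJk : J k ≤ J (κ i) + T (κ i) :=
    (le_add_sum_Ico_of_succ_le hmono hik).trans (by linarith [hIco_le_T (κ i) k])
  have h1 : J (κ i) < ε / 2 := by
    have := hi₁ i (le_trans (le_max_left _ _) hi₀i)
    rw [Real.dist_eq, sub_zero, abs_of_nonneg (hJ0 _)] at this
    exact this
  have h2 : T (κ i) < ε / 2 := by
    have := hn₀ i (le_trans (le_max_right _ _) hi₀i)
    rw [Real.dist_eq, sub_zero, Function.comp_apply, abs_of_nonneg (hTnonneg _)] at this
    exact this
  rw [Real.dist_eq, sub_zero, abs_of_nonneg (hJ0 k)]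
  linarith

end Literature.Analysis.FluidPDE.ConvexIntegration
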